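import Summits.QuantumFields.BalabanUV.Beta.D1BFx.RestKernelGhostUnit
import Literature.MathematicalPhysics.QuantumFieldTheory.Balaban1983to89.Beta.VolumeImages

/-!
# `BalabanUV.Beta.D1BFx.RestKernelGhostUnitJ` — road «BF-x» for binder row D1, slot (K), DICT-CHAIN-SPEC §2 (II) row RK-GH: **«RK-GH UNIT J» —
# THE TWELVE GHOST REST WORDS AS (5.10)-KERNELS AT GENERIC JETS, ON DISPLAYED JET LETTERS IN THE BRICKS' MASS CURRENCY** — my g18 FILE 4
# `RestKernelGhostUnit` (jets PINNED to the `wH`-pack `n²•vertexRedF ghCur` ∕ `n²•tableRedF gh₁₁`) with the jets `𝒱 𝒲` FREE: first jets with centred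
# weighted masses `≤ mV` at the legs' common rate `σn := min (δ_PP∕8) (κ′∕16)∕n`, tables with plain masses `≤ mW·e^{−κW|z|₁}` — the `hgh` letter shape of
# leaf-01 g23's «GHOST SLOT PACK J» `RkGhJ` and of the OWNER's PART 12b (`hgh hKg hκg`), to be INSTANTIATED at PART 7's gauged ghost jets by the sequel
# «GHOST ROWS AT THE ROAD» (gan24-leaf-05 g53's «G0-JET-MASS» ∕ «G0-TABLE-MASS» letters).

HONEST DEPENDENCY (cell records, verbatim): «continuum YM on T⁴ ⇐ BetaPertH ∧ nine spine estimates (0/9 proved); BetaPertH ⇐ (D1) ∧ (D4) ∧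
CAP+tail; G-an2-4 gates asym, D1 and NE2/3/4.»  HONEST FRAMING (cell contract, verbatim): «discharging `BetaPertH` makes Bałaban's UV stability
UNCONDITIONAL — a real constructive-QFT result; it is NOT the continuum limit and NOT the Clay problem.»  THIS MODULE DISCHARGES NOTHING of the
wall: [folklore] assembly BY NAME of my g18 bricks (`GhostWordFamilies.decay510_tadpoleWord_of_mass` ∕ `decay510_biBubbleWord_of_decays_bdd_mass` ∕
`…_of_bdd_decays_mass`), the leg letters at the common rate (`RestKernelGhostUnit.sigma_facts`, `decays_Ggh_sigma`, `decays_Pgt_sigma`, `decays_comp_*_sigma`,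
`GhostWordLegLetters.bdd_comp_*`), `decay510_half_mul` ∕ `decay510_neg_half_mul`, `decay510_mono_const` and `decay510_mono` (rate, `VolumeImages`).  UNCONDITIONAL in the
legs (`0 < a` only); the JET LETTERS are HYPOTHESES (displayed).  No definition, no `def … : Prop`, nothing cited, 0 sorry.  0 root-level binders of row D1 discharged
(hW ∕ hR-sockets ∕ hSX-socket ∕ D1Tel ∕ D1Rep — 0); (K) NOT closed; NOT D1, NOT `BetaPertH`, NOT continuum, NOT Clay.

ABSOLUTE RULE (cell charter, verbatim): «No internally-minted statement may enter as a cited fact. Every hypothesis is either kernel-proved in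
this package or a verbatim quotation of a PUBLISHED theorem with page reference. The manuscript(s) under audit are NOT citable for their own
disputed steps — they are the thing under adjudication; programme-internal (2001/route/tribunal) claims are never citable.»

THE COUNT (letters: `SP := cPPs∕n⁴`, `SG := 2∕min 2 a`, `MG := cNear a·latticeConst 4 (ghDelta a)`, `KPG := cPPs·e^{δ_PP}·SG·(1 + 16∕δ_PP)⁴`, `n = m+1`):
tadpoles `½·(SP·MG)·mW` (rate `κW`); single-`P` bubbles `½·(SG·MG)·(SP·e^{δ_PP})·mV²` ∕ `½·SG·(SP·MG)·mV²`; self doubles `½·KPG·(SP·MG)·mV²`; mixed doubles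
`½·(SP·e^{δ_PP})·(MG·(SP·MG))·mV²` (rate `σ₀ := min (δ_PP∕8) (κ′∕16)`).  Uniformly (§3): `(n⁴)⁻¹·(KT·mW + KB·mV²)` at the rate `min κW σ₀`.  At the `wH`-pack
(`mV ~ n`, `mW ~ n⁻⁴`) this is FILE 4's `n⁻²`; at PART 7's `colH G₀`-pack (`mV ~ n²`, `mW ~ n⁻²`, gan24-leaf-05) it is `n⁰` — unit class, zero margin.

CONTENT (all [folklore]): §1 `decay510_wordJ_tadpole`, `decay510_wordJ_single_none`, `decay510_wordJ_single_some`, `decay510_wordJ_double_self`,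
`decay510_wordJ_double_mixed`; §2 `decay510_wordJ_uniform` (one constant∕rate over `GhIdx`).  NOT HERE: the road's jets (sequel), the `Rk` packaging (leaf-01).
Unit `b2b-balaban-beta-d1-formalise-leaf-04` (gen 20), road «BF-x»; INTENT 3 «RK-GH UNIT J» (journal [D1LEAF04-G20-INTENT-3]).
-/

noncomputable section

open Finset
open scoped BigOperators
open Literature.MathematicalPhysics.QuantumFieldTheory.Balaban1983to89
open Literature.MathematicalPhysics.QuantumFieldTheory.Balaban1983to89.Beta
open B12Sec2to5 (l1 l1_nonneg Decay510)
open B4Sect5Proof (latticeConst latticeConst_nonneg)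
open B5Hk163Strip (kappa163 kappa163_pos)
open ExpKernelCalculus (Site MKer Decays comp decay510_mono_const)
open KernelWard (Bdd)
open Summit.QuantumFields.BalabanUV.Beta.D1BFx.RProjector (Pgt deltaPP deltaPP_pos)
open Summit.QuantumFields.BalabanUV.Beta.D1BFx.ProjectorSupNorm (cPPs cPPs_nonneg)
open Summit.QuantumFields.BalabanUV.Beta.D1BFx.GhostLeg (Ggh const_nonneg)
open Summit.QuantumFields.BalabanUV.Beta.D1BFx.GhostLegFree (ghDelta ghDelta_pos)
open Summit.QuantumFields.BalabanUV.Beta.D1BFx.GhostLegBlockMass (cNear)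
open Summit.QuantumFields.BalabanUV.Beta.D1BFx.RColumnBlockMass (cNear_nonneg)
open Summit.QuantumFields.BalabanUV.Beta.D1BFx.RestKernelGhostWords (GhIdx ghostWordK)
open Summit.QuantumFields.BalabanUV.Beta.D1BFx.GhostWordFamilies (decay510_tadpoleWord_of_mass decay510_biBubbleWord_of_decays_bdd_mass
  decay510_biBubbleWord_of_bdd_decays_mass)
open Summit.QuantumFields.BalabanUV.Beta.D1BFx.GhostWordLegLetters (bdd_comp_Pgt_Ggh bdd_comp_Ggh_Pgt bdd_comp_Ggh_Ggh bdd_comp_Ggh_Pgt_Ggh)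
open Summit.QuantumFields.BalabanUV.Beta.D1BFx.RestKernelGhostUnit (decay510_half_mul decay510_neg_half_mul sigma_facts decays_Ggh_sigma decays_Pgt_sigma
  decays_comp_Pgt_Ggh_sigma decays_comp_Ggh_Pgt_sigma)

namespace Summit.QuantumFields.BalabanUV.Beta.D1BFx.RestKernelGhostUnitJ

variable (m : ℕ) {a : ℝ} (ha : 0 < a) {𝒱 : Fin 4 → Site 4 → MKer 4 Unit} {𝒲 : Fin 4 → Site 4 → Fin 4 → Site 4 → MKer 4 Unit}
  {mV mW κW : ℝ} {μ ν : Fin 4}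

/-! ## §1 The twelve words at generic jets -/

section Words

include ha

/-- [folklore] **TADPOLES** `i = inl b` (`½·tadpole (G∘P ∣ P∘G) (𝒲 μ 0 ν z)`): on the table letter `(hWs, hWm)` (plain masses `≤ mW·e^{−κW|z|₁}`),
`Decay510 · (½·((cPPs∕n⁴)·MG)·mW) κW`. -/
theorem decay510_wordJ_tadpole
    (hWs : ∀ z : Site 4, Summable fun p : Site 4 × Site 4 => ∑ g, ∑ b, |𝒲 μ 0 ν z p.1 p.2 g b|)
    (hWm : ∀ z : Site 4, ∑' p : Site 4 × Site 4, ∑ g, ∑ b, |𝒲 μ 0 ν z p.1 p.2 g b| ≤ mW * Real.exp (-κW * l1 z)) (b : Bool) :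
    Decay510 (ghostWordK (Ggh (m + 1) a) (Pgt (m + 1) a) 𝒱 𝒲 (Sum.inl b) μ ν)
      ((1 / 2) * ((cPPs 4 a / ((m + 1 : ℕ) : ℝ) ^ 4 * (cNear a * latticeConst 4 (ghDelta a))) * mW)) κW := by
  have hS : 0 ≤ cPPs 4 a / ((m + 1 : ℕ) : ℝ) ^ 4 * (cNear a * latticeConst 4 (ghDelta a)) := by
    have := cPPs_nonneg 4 ha; have := cNear_nonneg ha; have := latticeConst_nonneg 4 (ghDelta_pos ha).le; positivity
  cases b
  · exact decay510_half_mul (decay510_tadpoleWord_of_mass (𝒲 := 𝒲) (bdd_comp_Pgt_Ggh (m + 1) ha) hS μ ν hWs hWm)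
  · have hL : Bdd (comp (Ggh (m + 1) a) (Pgt (m + 1) a)) (cPPs 4 a / ((m + 1 : ℕ) : ℝ) ^ 4 * (cNear a * latticeConst 4 (ghDelta a))) :=
      fun x y u v => (bdd_comp_Ggh_Pgt (m + 1) ha x y u v).trans (le_of_eq (mul_comm _ _))
    exact decay510_half_mul (decay510_tadpoleWord_of_mass (𝒲 := 𝒲) hL hS μ ν hWs hWm)

variable
  (hVs : ∀ (ρ : Fin 4) (y : Site 4), Summable fun p : Site 4 × Site 4 => ∑ g, ∑ f, |𝒱 ρ y p.1 p.2 g f|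
    * Real.exp ((min (deltaPP 4 a / 8) (kappa163 (3 + 1) / (3 + 1) / 16) / ((m + 1 : ℕ) : ℝ))
      * (l1 (p.1 - ((m + 1 : ℕ) : ℤ) • y) + l1 (p.2 - ((m + 1 : ℕ) : ℤ) • y))))
  (hVm : ∀ (ρ : Fin 4) (y : Site 4), ∑' p : Site 4 × Site 4, ∑ g, ∑ f, |𝒱 ρ y p.1 p.2 g f|
    * Real.exp ((min (deltaPP 4 a / 8) (kappa163 (3 + 1) / (3 + 1) / 16) / ((m + 1 : ℕ) : ℝ))
      * (l1 (p.1 - ((m + 1 : ℕ) : ℤ) • y) + l1 (p.2 - ((m + 1 : ℕ) : ℤ) • y))) ≤ mV)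
include hVs hVm

/-- [folklore] **SINGLE-`P` BUBBLES OVER `(G∘G, P)`** `i = inr (inl (none, s))` on the first-jet letter `(hVs, hVm)` (centred weighted masses `≤ mV` at the common
rate `σn`): `Decay510 · (½·((SG·MG)·(cPPs∕n⁴·e^{δ_PP}))·mV·mV) σ₀`. -/
theorem decay510_wordJ_single_none (s : Bool) :
    Decay510 (ghostWordK (Ggh (m + 1) a) (Pgt (m + 1) a) 𝒱 𝒲 (Sum.inr (Sum.inl (none, s))) μ ν)
      ((1 / 2) * ((2 / min 2 a * (cNear a * latticeConst 4 (ghDelta a))) * (cPPs 4 a / ((m + 1 : ℕ) : ℝ) ^ 4 * Real.exp (deltaPP 4 a)) * mV * mV))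
      (min (deltaPP 4 a / 8) (kappa163 (3 + 1) / (3 + 1) / 16)) := by
  obtain ⟨hσ0, -, -, -, hσN, -⟩ := sigma_facts m ha
  have hSGG : 0 ≤ 2 / min 2 a * (cNear a * latticeConst 4 (ghDelta a)) := by
    have := const_nonneg a ha; have := cNear_nonneg ha; have := latticeConst_nonneg 4 (ghDelta_pos ha).le; positivity
  have hSP : 0 ≤ cPPs 4 a / ((m + 1 : ℕ) : ℝ) ^ 4 * Real.exp (deltaPP 4 a) := by have := cPPs_nonneg 4 ha; positivity
  cases s
  · have h := decay510_biBubbleWord_of_bdd_decays_mass (𝒱 := 𝒱) (𝒱' := 𝒱) (bdd_comp_Ggh_Ggh (m + 1) ha) (decays_Pgt_sigma m ha) hσ0 hSGG hSP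
      μ ν (hVs μ) (hVm μ) (hVs ν) (hVm ν)
    rw [hσN] at h
    exact decay510_mono_const (decay510_neg_half_mul h) (le_of_eq (by ring))
  · have h := decay510_biBubbleWord_of_decays_bdd_mass (𝒱 := 𝒱) (𝒱' := 𝒱) (decays_Pgt_sigma m ha) (bdd_comp_Ggh_Ggh (m + 1) ha) hσ0 hSP hSGG
      μ ν (hVs μ) (hVm μ) (hVs ν) (hVm ν)
    rw [hσN] at h
    exact decay510_mono_const (decay510_neg_half_mul h) (le_of_eq (by ring))

/-- [folklore] **SINGLE-`P` BUBBLES OVER `(G, P∘G)` AND `(G, G∘P)`** `i = inr (inl (some t, s))`: `Decay510 · (½·(SG·((cPPs∕n⁴)·MG))·mV·mV) σ₀`. -/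
theorem decay510_wordJ_single_some (t s : Bool) :
    Decay510 (ghostWordK (Ggh (m + 1) a) (Pgt (m + 1) a) 𝒱 𝒲 (Sum.inr (Sum.inl (some t, s))) μ ν)
      ((1 / 2) * ((2 / min 2 a) * (cPPs 4 a / ((m + 1 : ℕ) : ℝ) ^ 4 * (cNear a * latticeConst 4 (ghDelta a))) * mV * mV))
      (min (deltaPP 4 a / 8) (kappa163 (3 + 1) / (3 + 1) / 16)) := by
  obtain ⟨hσ0, -, -, -, hσN, -⟩ := sigma_facts m ha
  have hSG : 0 ≤ 2 / min 2 a := const_nonneg a ha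
  have hB : 0 ≤ cPPs 4 a / ((m + 1 : ℕ) : ℝ) ^ 4 * (cNear a * latticeConst 4 (ghDelta a)) := by
    have := cPPs_nonneg 4 ha; have := cNear_nonneg ha; have := latticeConst_nonneg 4 (ghDelta_pos ha).le; positivity
  have hB' : 0 ≤ (cNear a * latticeConst 4 (ghDelta a)) * (cPPs 4 a / ((m + 1 : ℕ) : ℝ) ^ 4) := by rw [mul_comm]; exact hB
  cases t <;> cases s
  · have h := decay510_biBubbleWord_of_decays_bdd_mass (𝒱 := 𝒱) (𝒱' := 𝒱) (decays_Ggh_sigma m ha) (bdd_comp_Pgt_Ggh (m + 1) ha) hσ0 hSG hB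
      μ ν (hVs μ) (hVm μ) (hVs ν) (hVm ν)
    rw [hσN] at h
    exact decay510_mono_const (decay510_neg_half_mul h) (le_of_eq (by ring))
  · have h := decay510_biBubbleWord_of_bdd_decays_mass (𝒱 := 𝒱) (𝒱' := 𝒱) (bdd_comp_Pgt_Ggh (m + 1) ha) (decays_Ggh_sigma m ha) hσ0 hB hSG
      μ ν (hVs μ) (hVm μ) (hVs ν) (hVm ν)
    rw [hσN] at h
    exact decay510_mono_const (decay510_neg_half_mul h) (le_of_eq (by ring))
  · have h := decay510_biBubbleWord_of_decays_bdd_mass (𝒱 := 𝒱) (𝒱' := 𝒱) (decays_Ggh_sigma m ha) (bdd_comp_Ggh_Pgt (m + 1) ha) hσ0 hSG hB'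
      μ ν (hVs μ) (hVm μ) (hVs ν) (hVm ν)
    rw [hσN] at h
    exact decay510_mono_const (decay510_neg_half_mul h) (le_of_eq (by ring))
  · have h := decay510_biBubbleWord_of_bdd_decays_mass (𝒱 := 𝒱) (𝒱' := 𝒱) (bdd_comp_Ggh_Pgt (m + 1) ha) (decays_Ggh_sigma m ha) hσ0 hB' hSG
      μ ν (hVs μ) (hVm μ) (hVs ν) (hVm ν)
    rw [hσN] at h
    exact decay510_mono_const (decay510_neg_half_mul h) (le_of_eq (by ring))

/-- [folklore] **SELF DOUBLE-`P` BUBBLES** `i = inr (inr (inl b))`: `Decay510 · (½·(KPG·((cPPs∕n⁴)·MG))·mV·mV) σ₀`, `KPG := cPPs·e^{δ_PP}·SG·(1 + 16∕δ_PP)⁴`. -/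
theorem decay510_wordJ_double_self (b : Bool) :
    Decay510 (ghostWordK (Ggh (m + 1) a) (Pgt (m + 1) a) 𝒱 𝒲 (Sum.inr (Sum.inr (Sum.inl b))) μ ν)
      ((1 / 2) * ((cPPs 4 a * Real.exp (deltaPP 4 a) * (2 / min 2 a) * (1 + 16 / deltaPP 4 a) ^ 4)
        * (cPPs 4 a / ((m + 1 : ℕ) : ℝ) ^ 4 * (cNear a * latticeConst 4 (ghDelta a))) * mV * mV))
      (min (deltaPP 4 a / 8) (kappa163 (3 + 1) / (3 + 1) / 16)) := by
  obtain ⟨hσ0, -, -, -, hσN, -⟩ := sigma_facts m ha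
  have hK : 0 ≤ cPPs 4 a * Real.exp (deltaPP 4 a) * (2 / min 2 a) * (1 + 16 / deltaPP 4 a) ^ 4 := by
    have := cPPs_nonneg 4 ha; have := const_nonneg a ha; have := deltaPP_pos 4 ha; positivity
  have hK' : 0 ≤ (2 / min 2 a) * (cPPs 4 a * Real.exp (deltaPP 4 a)) * (1 + 16 / deltaPP 4 a) ^ 4 := by
    have := cPPs_nonneg 4 ha; have := const_nonneg a ha; have := deltaPP_pos 4 ha; positivity
  have hB : 0 ≤ cPPs 4 a / ((m + 1 : ℕ) : ℝ) ^ 4 * (cNear a * latticeConst 4 (ghDelta a)) := by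
    have := cPPs_nonneg 4 ha; have := cNear_nonneg ha; have := latticeConst_nonneg 4 (ghDelta_pos ha).le; positivity
  have hB' : 0 ≤ (cNear a * latticeConst 4 (ghDelta a)) * (cPPs 4 a / ((m + 1 : ℕ) : ℝ) ^ 4) := by rw [mul_comm]; exact hB
  cases b
  · have h := decay510_biBubbleWord_of_decays_bdd_mass (𝒱 := 𝒱) (𝒱' := 𝒱) (decays_comp_Pgt_Ggh_sigma m ha) (bdd_comp_Pgt_Ggh (m + 1) ha)
      hσ0 hK hB μ ν (hVs μ) (hVm μ) (hVs ν) (hVm ν)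
    rw [hσN] at h
    exact decay510_mono_const (decay510_half_mul h) (le_of_eq (by ring))
  · have h := decay510_biBubbleWord_of_decays_bdd_mass (𝒱 := 𝒱) (𝒱' := 𝒱) (decays_comp_Ggh_Pgt_sigma m ha) (bdd_comp_Ggh_Pgt (m + 1) ha)
      hσ0 hK' hB' μ ν (hVs μ) (hVm μ) (hVs ν) (hVm ν)
    rw [hσN] at h
    exact decay510_mono_const (decay510_half_mul h) (le_of_eq (by ring))

/-- [folklore] **MIXED DOUBLE-`P` BUBBLES** `i = inr (inr (inr b))`: `Decay510 · (½·((cPPs∕n⁴·e^{δ_PP})·(MG·((cPPs∕n⁴)·MG)))·mV·mV) σ₀`. -/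
theorem decay510_wordJ_double_mixed (b : Bool) :
    Decay510 (ghostWordK (Ggh (m + 1) a) (Pgt (m + 1) a) 𝒱 𝒲 (Sum.inr (Sum.inr (Sum.inr b))) μ ν)
      ((1 / 2) * ((cPPs 4 a / ((m + 1 : ℕ) : ℝ) ^ 4 * Real.exp (deltaPP 4 a))
        * ((cNear a * latticeConst 4 (ghDelta a)) * (cPPs 4 a / ((m + 1 : ℕ) : ℝ) ^ 4 * (cNear a * latticeConst 4 (ghDelta a)))) * mV * mV))
      (min (deltaPP 4 a / 8) (kappa163 (3 + 1) / (3 + 1) / 16)) := by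
  obtain ⟨hσ0, -, -, -, hσN, -⟩ := sigma_facts m ha
  have hSP : 0 ≤ cPPs 4 a / ((m + 1 : ℕ) : ℝ) ^ 4 * Real.exp (deltaPP 4 a) := by have := cPPs_nonneg 4 ha; positivity
  have hB : 0 ≤ (cNear a * latticeConst 4 (ghDelta a)) * (cPPs 4 a / ((m + 1 : ℕ) : ℝ) ^ 4 * (cNear a * latticeConst 4 (ghDelta a))) := by
    have := cPPs_nonneg 4 ha; have := cNear_nonneg ha; have := latticeConst_nonneg 4 (ghDelta_pos ha).le; positivity
  cases b
  · have h := decay510_biBubbleWord_of_bdd_decays_mass (𝒱 := 𝒱) (𝒱' := 𝒱) (bdd_comp_Ggh_Pgt_Ggh (m + 1) ha) (decays_Pgt_sigma m ha) hσ0 hB hSP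
      μ ν (hVs μ) (hVm μ) (hVs ν) (hVm ν)
    rw [hσN] at h
    exact decay510_mono_const (decay510_half_mul h) (le_of_eq (by ring))
  · have h := decay510_biBubbleWord_of_decays_bdd_mass (𝒱 := 𝒱) (𝒱' := 𝒱) (decays_Pgt_sigma m ha) (bdd_comp_Ggh_Pgt_Ggh (m + 1) ha) hσ0 hSP hB
      μ ν (hVs μ) (hVm μ) (hVs ν) (hVm ν)
    rw [hσN] at h
    exact decay510_mono_const (decay510_half_mul h) (le_of_eq (by ring))

end Words

/-! ## §2 One constant and one rate over `GhIdx` -/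

section Uniform

/-- [folklore] Pure arithmetic, tadpoles: `½·(P∕N⁴·M)·mW ≤ (N⁴)⁻¹·(KT + KB)`. -/
theorem aux_tadpole {P E G M Q mV mW N : ℝ} (hN : 1 ≤ N) (hP : 0 ≤ P) (hE : 0 ≤ E) (hG : 0 ≤ G) (hM : 0 ≤ M) (hQ : 0 ≤ Q) (hV : 0 ≤ mV) :
    (1 / 2) * (P / N ^ 4 * M * mW) ≤ (N ^ 4)⁻¹ * ((1 / 2) * (P * M) * mW
        + (1 / 2) * ((G * M) * (P * E) + G * (P * M) + (P * E * G * Q) * (P * M) + (P * E) * (M * (P * M))) * mV * mV) := by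
  have hN0 : 0 < N := by linarith
  have e : (1 / 2) * (P / N ^ 4 * M * mW) = (N ^ 4)⁻¹ * ((1 / 2) * (P * M) * mW) := by rw [div_eq_mul_inv]; ring
  rw [e]
  exact mul_le_mul_of_nonneg_left (le_add_of_nonneg_right (by positivity)) (by positivity)

/-- [folklore] Pure arithmetic, the three single∕self bubble shapes: a summand of `KB` is `≤ KT + KB` (all letters nonnegative). -/
theorem aux_bubble {P E G M Q mV mW N X : ℝ} (hN : 1 ≤ N) (hP : 0 ≤ P) (hM : 0 ≤ M) (hV : 0 ≤ mV) (hW : 0 ≤ mW)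
    (hX : X ≤ (G * M) * (P * E) + G * (P * M) + (P * E * G * Q) * (P * M) + (P * E) * (M * (P * M))) :
    (N ^ 4)⁻¹ * ((1 / 2) * X * mV * mV) ≤ (N ^ 4)⁻¹ * ((1 / 2) * (P * M) * mW
        + (1 / 2) * ((G * M) * (P * E) + G * (P * M) + (P * E * G * Q) * (P * M) + (P * E) * (M * (P * M))) * mV * mV) := by
  have hN0 : 0 < N := by linarith
  refine mul_le_mul_of_nonneg_left ?_ (by positivity)
  have h1 : 0 ≤ (1 / 2) * (P * M) * mW := by positivity
  have h2 : (1 / 2) * X * mV * mV ≤ (1 / 2) * ((G * M) * (P * E) + G * (P * M) + (P * E * G * Q) * (P * M) + (P * E) * (M * (P * M))) * mV * mV :=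
    mul_le_mul_of_nonneg_right (mul_le_mul_of_nonneg_right (mul_le_mul_of_nonneg_left hX (by norm_num)) hV) hV
  linarith

variable {m}
include ha

/-- [folklore] **THE TWELVE WORDS UNDER ONE CONSTANT AND ONE RATE**: on the jet letters `(hVs, hVm)` (first jets, common rate `σn`, `0 ≤ mV` displayed) and
`(hWs, hWm)` (tables, rate `κW`), for every `i : GhIdx`,
`Decay510 (ghostWordK (Ggh n a) (Pgt n a) 𝒱 𝒲 i μ ν) ((n⁴)⁻¹·(KT·mW + KB·mV·mV)) (min κW σ₀)` with the n-free
`KT := ½·cPPs·MG`, `KB := ½·(SG·MG·cPPs·e^{δ_PP} + SG·cPPs·MG + KPG·cPPs·MG + cPPs·e^{δ_PP}·MG·cPPs·MG)` (the mixed doubles' second `n⁻⁴` dropped by `(n⁴)⁻¹ ≤ 1`). -/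
theorem decay510_wordJ_uniform
    (hVs : ∀ (ρ : Fin 4) (y : Site 4), Summable fun p : Site 4 × Site 4 => ∑ g, ∑ f, |𝒱 ρ y p.1 p.2 g f|
      * Real.exp ((min (deltaPP 4 a / 8) (kappa163 (3 + 1) / (3 + 1) / 16) / ((m + 1 : ℕ) : ℝ))
        * (l1 (p.1 - ((m + 1 : ℕ) : ℤ) • y) + l1 (p.2 - ((m + 1 : ℕ) : ℤ) • y))))
    (hVm : ∀ (ρ : Fin 4) (y : Site 4), ∑' p : Site 4 × Site 4, ∑ g, ∑ f, |𝒱 ρ y p.1 p.2 g f|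
      * Real.exp ((min (deltaPP 4 a / 8) (kappa163 (3 + 1) / (3 + 1) / 16) / ((m + 1 : ℕ) : ℝ))
        * (l1 (p.1 - ((m + 1 : ℕ) : ℤ) • y) + l1 (p.2 - ((m + 1 : ℕ) : ℤ) • y))) ≤ mV)
    (hWs : ∀ z : Site 4, Summable fun p : Site 4 × Site 4 => ∑ g, ∑ b, |𝒲 μ 0 ν z p.1 p.2 g b|)
    (hWm : ∀ z : Site 4, ∑' p : Site 4 × Site 4, ∑ g, ∑ b, |𝒲 μ 0 ν z p.1 p.2 g b| ≤ mW * Real.exp (-κW * l1 z))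
    (hmV : 0 ≤ mV) (i : GhIdx) :
    Decay510 (ghostWordK (Ggh (m + 1) a) (Pgt (m + 1) a) 𝒱 𝒲 i μ ν)
      (((((m + 1 : ℕ) : ℝ)) ^ 4)⁻¹ * ((1 / 2) * (cPPs 4 a * (cNear a * latticeConst 4 (ghDelta a))) * mW
        + (1 / 2) * ((2 / min 2 a * (cNear a * latticeConst 4 (ghDelta a))) * (cPPs 4 a * Real.exp (deltaPP 4 a))
            + (2 / min 2 a) * (cPPs 4 a * (cNear a * latticeConst 4 (ghDelta a)))
            + (cPPs 4 a * Real.exp (deltaPP 4 a) * (2 / min 2 a) * (1 + 16 / deltaPP 4 a) ^ 4) * (cPPs 4 a * (cNear a * latticeConst 4 (ghDelta a)))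
            + (cPPs 4 a * Real.exp (deltaPP 4 a)) * ((cNear a * latticeConst 4 (ghDelta a)) * (cPPs 4 a * (cNear a * latticeConst 4 (ghDelta a)))))
          * mV * mV))
      (min κW (min (deltaPP 4 a / 8) (kappa163 (3 + 1) / (3 + 1) / 16))) := by
  have hn1 : (1 : ℝ) ≤ ((m + 1 : ℕ) : ℝ) := by exact_mod_cast Nat.le_add_left 1 m
  have hn0 : (0 : ℝ) < ((m + 1 : ℕ) : ℝ) := by linarith
  have hP0 : 0 ≤ cPPs 4 a := cPPs_nonneg 4 ha
  have hE0 : 0 ≤ Real.exp (deltaPP 4 a) := (Real.exp_pos _).le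
  have hG0 : 0 ≤ 2 / min 2 a := const_nonneg a ha
  have hM0 : 0 ≤ cNear a * latticeConst 4 (ghDelta a) := by
    have := cNear_nonneg ha; have := latticeConst_nonneg 4 (ghDelta_pos ha).le; positivity
  have hQ0 : 0 ≤ (1 + 16 / deltaPP 4 a) ^ 4 := by have := deltaPP_pos 4 ha; positivity
  have hmW : 0 ≤ mW := by
    have h := hWm 0
    have e : l1 (0 : Site 4) = 0 := by simp [B12Sec2to5.l1]
    rw [e, mul_zero, Real.exp_zero, mul_one] at h
    exact (tsum_nonneg fun p => Finset.sum_nonneg fun g _ => Finset.sum_nonneg fun f _ => abs_nonneg _).trans h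
  have hT1 : 0 ≤ (2 / min 2 a * (cNear a * latticeConst 4 (ghDelta a))) * (cPPs 4 a * Real.exp (deltaPP 4 a)) := by positivity
  have hT2 : 0 ≤ (2 / min 2 a) * (cPPs 4 a * (cNear a * latticeConst 4 (ghDelta a))) := by positivity
  have hT3 : 0 ≤ (cPPs 4 a * Real.exp (deltaPP 4 a) * (2 / min 2 a) * (1 + 16 / deltaPP 4 a) ^ 4) * (cPPs 4 a * (cNear a * latticeConst 4 (ghDelta a))) := by
    positivity
  have hT4 : 0 ≤ (cPPs 4 a * Real.exp (deltaPP 4 a)) * ((cNear a * latticeConst 4 (ghDelta a)) * (cPPs 4 a * (cNear a * latticeConst 4 (ghDelta a)))) := by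
    positivity
  have hrate₁ : min κW (min (deltaPP 4 a / 8) (kappa163 (3 + 1) / (3 + 1) / 16)) ≤ κW := min_le_left _ _
  have hrate₂ : min κW (min (deltaPP 4 a / 8) (kappa163 (3 + 1) / (3 + 1) / 16)) ≤ min (deltaPP 4 a / 8) (kappa163 (3 + 1) / (3 + 1) / 16) :=
    min_le_right _ _
  rcases i with b | ⟨π, s⟩ | b | b
  · exact decay510_mono (decay510_mono_const (decay510_wordJ_tadpole m ha (𝒱 := 𝒱) hWs hWm b) (aux_tadpole hn1 hP0 hE0 hG0 hM0 hQ0 hmV)) hrate₁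
  · rcases π with _ | t
    · have h := decay510_wordJ_single_none m ha (𝒲 := 𝒲) (μ := μ) (ν := ν) hVs hVm s
      have e : (1 / 2) * ((2 / min 2 a * (cNear a * latticeConst 4 (ghDelta a))) * (cPPs 4 a / ((m + 1 : ℕ) : ℝ) ^ 4 * Real.exp (deltaPP 4 a)) * mV * mV)
          = ((((m + 1 : ℕ) : ℝ)) ^ 4)⁻¹ * ((1 / 2) * ((2 / min 2 a * (cNear a * latticeConst 4 (ghDelta a))) * (cPPs 4 a * Real.exp (deltaPP 4 a))) * mV * mV) := by
        rw [div_eq_mul_inv]; ring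
      rw [e] at h
      exact decay510_mono (decay510_mono_const h (aux_bubble hn1 hP0 hM0 hmV hmW (by linarith))) hrate₂
    · have h := decay510_wordJ_single_some m ha (𝒲 := 𝒲) (μ := μ) (ν := ν) hVs hVm t s
      have e : (1 / 2) * ((2 / min 2 a) * (cPPs 4 a / ((m + 1 : ℕ) : ℝ) ^ 4 * (cNear a * latticeConst 4 (ghDelta a))) * mV * mV)
          = ((((m + 1 : ℕ) : ℝ)) ^ 4)⁻¹ * ((1 / 2) * ((2 / min 2 a) * (cPPs 4 a * (cNear a * latticeConst 4 (ghDelta a)))) * mV * mV) := by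
        rw [div_eq_mul_inv]; ring
      rw [e] at h
      exact decay510_mono (decay510_mono_const h (aux_bubble hn1 hP0 hM0 hmV hmW (by linarith))) hrate₂
  · have h := decay510_wordJ_double_self m ha (𝒲 := 𝒲) (μ := μ) (ν := ν) hVs hVm b
    have e : (1 / 2) * ((cPPs 4 a * Real.exp (deltaPP 4 a) * (2 / min 2 a) * (1 + 16 / deltaPP 4 a) ^ 4)
          * (cPPs 4 a / ((m + 1 : ℕ) : ℝ) ^ 4 * (cNear a * latticeConst 4 (ghDelta a))) * mV * mV)
        = ((((m + 1 : ℕ) : ℝ)) ^ 4)⁻¹ * ((1 / 2) * ((cPPs 4 a * Real.exp (deltaPP 4 a) * (2 / min 2 a) * (1 + 16 / deltaPP 4 a) ^ 4)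
          * (cPPs 4 a * (cNear a * latticeConst 4 (ghDelta a)))) * mV * mV) := by
      rw [div_eq_mul_inv]; ring
    rw [e] at h
    exact decay510_mono (decay510_mono_const h (aux_bubble hn1 hP0 hM0 hmV hmW (by linarith))) hrate₂
  · have h := decay510_wordJ_double_mixed m ha (𝒲 := 𝒲) (μ := μ) (ν := ν) hVs hVm b
    -- the second `n⁻⁴` is dropped: `(n⁴)⁻¹ ≤ 1`
    have hI1 : ((((m + 1 : ℕ) : ℝ)) ^ 4)⁻¹ ≤ 1 := inv_le_one_of_one_le₀ (one_le_pow₀ hn1)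
    have hT4' : 0 ≤ (1 / 2) * ((cPPs 4 a * Real.exp (deltaPP 4 a)) * ((cNear a * latticeConst 4 (ghDelta a))
        * (cPPs 4 a * (cNear a * latticeConst 4 (ghDelta a))))) * mV * mV := by positivity
    have e : (1 / 2) * ((cPPs 4 a / ((m + 1 : ℕ) : ℝ) ^ 4 * Real.exp (deltaPP 4 a))
          * ((cNear a * latticeConst 4 (ghDelta a)) * (cPPs 4 a / ((m + 1 : ℕ) : ℝ) ^ 4 * (cNear a * latticeConst 4 (ghDelta a)))) * mV * mV)
        = ((((m + 1 : ℕ) : ℝ)) ^ 4)⁻¹ * (((((m + 1 : ℕ) : ℝ)) ^ 4)⁻¹ * ((1 / 2) * ((cPPs 4 a * Real.exp (deltaPP 4 a))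
          * ((cNear a * latticeConst 4 (ghDelta a)) * (cPPs 4 a * (cNear a * latticeConst 4 (ghDelta a))))) * mV * mV)) := by
      rw [div_eq_mul_inv]; ring
    rw [e] at h
    have h' := decay510_mono_const h (mul_le_mul_of_nonneg_left ((mul_le_mul_of_nonneg_right hI1 hT4').trans (le_of_eq (one_mul _))) (by positivity))
    exact decay510_mono (decay510_mono_const h' (aux_bubble hn1 hP0 hM0 hmV hmW (by linarith))) hrate₂

end Uniform

end Summit.QuantumFields.BalabanUV.Beta.D1BFx.RestKernelGhostUnitJ

end
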